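import Summits.QuantumFields.BalabanUV.Beta.D1BFx.GhostDeltaTableMass
import Summits.QuantumFields.BalabanUV.Beta.D1BFx.GhostDeltaWords
import Summits.QuantumFields.BalabanUV.Beta.D1BFx.GhostSqrtLegPins

/-!
# The «ΔGH» jets, III: the three jet masses with their powers of `n`

Road «BF-x» (BetaPertH (D1) dictionary chain), unit `b2b-balaban-beta-d1-formalise-leaf-04` (gen 18), «RK-GH-UNIT» FILE 5d (OWNER RULING
ρ-g16-2 «ΔGH DIRECT»). The three jets of the four «ΔGH» words of `GhostDeltaWords.deltaGH_eq_words` — `V_Q := vertexRedF n (SghAt ρ n 0 cQ)`,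
`V_K := vertexRedF n (SghAt ρ n cK 0)`, `W_Q := tableRedF n (WghAt ρ n x₀ 0 cQ)` — in the currency of FILE 1b (`GhostWordFamilies`): for every
in-block root `ρ`, `n = m + 1`, `κ₁ = kappa163 4∕4`, `M·P = MG163 4·periodConst (kappa163 4) 3`,
* **`mass_vertexRedF_SghAt_Q_le`** — centred weighted mass of `V_Q μ y` (rate `0 ≤ σ ≤ κ₁∕(16n)`) `≤ |cQ|·8·e^{κ₁}·(M·P·e^{κ₁})·(1 + 16∕κ₁)⁴` — **power `n⁰`**
  (four colours × FILE 5b's `tsum_wH_stencilMass_le`);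
* **`mass_vertexRedF_SghAt_K_le`** — at the pin `cK = n²`, `V_K = n²•vertexRedF n ghCur` (`vertexRedF_SghAt_K`, `GhostSqrtLegPins.vertexRedF_smul`), so
  FILE 3b's `mass_vertexRedF_ghCur_le` applies verbatim: `≤ 8·e^{κ₁∕16}·(M·P)·e^{κ₁}·(1 + 16∕κ₁)⁴ · n` — **power `n¹`**;
* **`mass_tableRedF_WghAt_Q_le`** — plain mass of `W_Q μ 0 ν z`: `W_Q = (−x₀cQn⁴)•tableRedF n (qSqAt ρ n)` (`tableRedF_WghAt_Q`: `WghAt_eq`, 5a's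
  `diagExt_zero_smul`, `tableRedF_smul`), so FILE 5c's `mass_tableRedF_qSqAt_le` gives `≤ |x₀|·|cQ|·64·e^{κ₁}·(M·P·e^{κ₁})²·(1 + 16∕κ₁)⁴ · n⁻¹ ·
  e^{−(κ₁∕8)|z|₁}` — **power `n⁻¹`**, coarse decay rate `κ₁∕8`.
[folklore]; 0 sorry ∕ new def ∕ `def … : Prop` ∕ cite. HONEST: estimates about OUR packed objects; 0 root-level binders discharged; (K) NOT closed;
NOT D1, NOT BetaPertH, NOT continuum, NOT Clay.
-/

open Finset
open scoped BigOperators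
open Literature.MathematicalPhysics.QuantumFieldTheory.Balaban1983to89
open Literature.MathematicalPhysics.QuantumFieldTheory.Balaban1983to89.Beta
open B12Sec2to5 (l1 l1_nonneg)
open B5Hk163Strip (kappa163 kappa163_pos)
open B5Hk163Decay (MG163)
open B4TorusKernel (periodConst)
open B6QGQLower276 (blk B mem_B)
open ExpKernelCalculus (Site MKer)
open KernelSpecInstance (wH)
open OneStepResolventKernel (wsum)
open Summit.QuantumFields.BalabanUV.Beta.D1BFx.GhostStencil (ghCur)
open Summit.QuantumFields.BalabanUV.Beta.D1BFx.GhostStencilRooted (qJetAt qAntiAt SghAt SghAt_apply)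
open Summit.QuantumFields.BalabanUV.Beta.D1BFx.GhostAveragingSquare (qSqAt WghAt WghAt_eq)
open Summit.QuantumFields.BalabanUV.Beta.D1BFx.ReducedKernelF (vertexRedF)
open Summit.QuantumFields.BalabanUV.Beta.D1BFx.ReducedTableF (tableRedF)
open Summit.QuantumFields.BalabanUV.Beta.D1BFx.GhostSqrtLegPins (vertexRedF_smul tableRedF_smul)
open Summit.QuantumFields.BalabanUV.Beta.D1BFx.GhostWordJetMass (mass_wsum_le mass_finset_sum_le mass_smul_le vertexRedF_eq_sum)
open Summit.QuantumFields.BalabanUV.Beta.D1BFx.GhostWordJetLetters (mass_vertexRedF_ghCur_le)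
open Summit.QuantumFields.BalabanUV.Beta.D1BFx.GhostDeltaJetLetters (mass_qAntiAt_stencil_le SghAt_Q_eq_smul tsum_wH_stencilMass_le)
open Summit.QuantumFields.BalabanUV.Beta.D1BFx.GhostDeltaTableMass (mass_tableRedF_qSqAt_le)
open Summit.QuantumFields.BalabanUV.Beta.D1BFx.GhostDeltaWords (diagExt_zero_smul)

namespace Summit.QuantumFields.BalabanUV.Beta.D1BFx.GhostDeltaJetMasses

/-! ## §1 The packed `Q′*Q′` vertex `V_Q` — power `n⁰` -/

section Vertex
variable (m : ℕ)

/-- [folklore] **THE «ΔGH» VERTEX JET'S MASS IS `O(|cQ|)·n⁰`**: for an in-block root `ρ`, `0 ≤ σ ≤ κ₁∕(16n)`, the centred weighted ℓ¹-mass of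
`vertexRedF n (SghAt ρ n 0 cQ) μ y` at `n•y`, rate `σ`, is summable and
`≤ |cQ| · 8·e^{κ₁}·(MG163 4·periodConst (kappa163 4) 3·e^{κ₁})·(1 + 16∕κ₁)⁴` — **power `n⁰`** (four colours × `tsum_wH_stencilMass_le`). -/
theorem mass_vertexRedF_SghAt_Q_le {ρ : Site 4} (hρ : ∀ i : Fin 4, 0 ≤ ρ i ∧ ρ i < (m + 1 : ℕ)) {σ : ℝ} (hσ0 : 0 ≤ σ)
    (hσ : σ ≤ kappa163 (3 + 1) / (3 + 1) / (16 * ((m + 1 : ℕ) : ℝ))) (cQ : ℝ) (μ : Fin 4) (y : Site 4) :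
    (Summable fun p : Site 4 × Site 4 => ∑ a, ∑ b,
        |vertexRedF (m + 1) (SghAt ρ (m + 1) 0 cQ) μ y p.1 p.2 a b| * Real.exp (σ * (l1 (p.1 - ((m + 1 : ℕ) : ℤ) • y) + l1 (p.2 - ((m + 1 : ℕ) : ℤ) • y)))) ∧
      ∑' p : Site 4 × Site 4, ∑ a, ∑ b,
        |vertexRedF (m + 1) (SghAt ρ (m + 1) 0 cQ) μ y p.1 p.2 a b| * Real.exp (σ * (l1 (p.1 - ((m + 1 : ℕ) : ℤ) • y) + l1 (p.2 - ((m + 1 : ℕ) : ℤ) • y)))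
        ≤ |cQ| * (8 * Real.exp (kappa163 (3 + 1) / (3 + 1)) *
            ((MG163 (3 + 1) * periodConst (kappa163 (3 + 1)) 3) * Real.exp (kappa163 (3 + 1) / (3 + 1))) * (1 + 16 / (kappa163 (3 + 1) / (3 + 1))) ^ 4) := by
  set n : ℕ := m + 1 with hn
  set c : Site 4 := ((m + 1 : ℕ) : ℤ) • y with hc
  have hW : ∀ p : Site 4 × Site 4, 0 < Real.exp (σ * (l1 (p.1 - c) + l1 (p.2 - c))) := fun p => Real.exp_pos _
  -- per colour: the superposition of the `cQ•qAntiAt` stencils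
  have hcol : ∀ κ' : Fin 4,
      (Summable fun p : Site 4 × Site 4 => ∑ a, ∑ b,
        |wsum (fun u => wH (N := n) (d := 3) κ' μ (u - (n : ℤ) • y)) (SghAt ρ n 0 cQ κ') p.1 p.2 a b| * Real.exp (σ * (l1 (p.1 - c) + l1 (p.2 - c)))) ∧
      ∑' p : Site 4 × Site 4, ∑ a, ∑ b,
        |wsum (fun u => wH (N := n) (d := 3) κ' μ (u - (n : ℤ) • y)) (SghAt ρ n 0 cQ κ') p.1 p.2 a b| * Real.exp (σ * (l1 (p.1 - c) + l1 (p.2 - c)))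
        ≤ |cQ| * (2 * Real.exp (kappa163 (3 + 1) / (3 + 1)) *
            ((MG163 (3 + 1) * periodConst (kappa163 (3 + 1)) 3) * Real.exp (kappa163 (3 + 1) / (3 + 1))) * (1 + 16 / (kappa163 (3 + 1) / (3 + 1))) ^ 4) := by
    intro κ'
    have hT := tsum_wH_stencilMass_le m hρ hσ κ' μ y cQ
    rw [← hc] at hT
    have hst : ∀ u, (Summable fun p : Site 4 × Site 4 => ∑ a, ∑ b, |SghAt ρ n 0 cQ κ' u p.1 p.2 a b| * Real.exp (σ * (l1 (p.1 - c) + l1 (p.2 - c)))) ∧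
        ∑' p : Site 4 × Site 4, ∑ a, ∑ b, |SghAt ρ n 0 cQ κ' u p.1 p.2 a b| * Real.exp (σ * (l1 (p.1 - c) + l1 (p.2 - c)))
          ≤ |cQ| * (Real.exp (σ * ((4 * ((n : ℕ) : ℝ) + l1 (u - c)) + (4 * ((n : ℕ) : ℝ) + l1 (u - c)))) *
              ∑ x ∈ B (n - 1) (blk (n - 1) u), ∑ z ∈ B (n - 1) (blk (n - 1) u),
                (|qJetAt ρ n κ' u (blk (n - 1) u) z| + |qJetAt ρ n κ' u (blk (n - 1) u) x|)) := by
      intro u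
      have h := mass_qAntiAt_stencil_le ρ n κ' hσ0 c u
      rw [SghAt_Q_eq_smul]
      exact mass_smul_le h.1 h.2
    have h := mass_wsum_le (F := Unit) hW (fun u => (hst u).1) (fun u => (hst u).2) hT.1
    exact ⟨h.1, h.2.trans hT.2⟩
  rw [vertexRedF_eq_sum]
  have h := mass_finset_sum_le (F := Unit) (Finset.univ : Finset (Fin 4)) (fun p => (hW p).le) (fun κ' _ => (hcol κ').1) (fun κ' _ => (hcol κ').2)
  refine ⟨h.1, h.2.trans (le_of_eq ?_)⟩
  rw [Finset.sum_const, Finset.card_univ, Fintype.card_fin, nsmul_eq_mul]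
  push_cast
  ring

end Vertex

/-! ## §2 The kinetic vertex `V_K` at the pin `cK = n²` — power `n¹` -/

section Kinetic
variable (ρ : Site 4) (n : ℕ) [NeZero n] (κ' : Fin 4)

omit [NeZero n] in
/-- [folklore] The `cK`-sector of the completed stencil is the scaled fine ghost current: `SghAt ρ n cK 0 κ′ u = cK • ghCur κ′ u`. -/
theorem SghAt_K_eq_smul (cK : ℝ) (u : Site 4) : SghAt ρ n cK 0 κ' u = cK • ghCur κ' u := by
  funext x z a b
  rw [SghAt_apply, Pi.smul_apply, Pi.smul_apply, Pi.smul_apply, Pi.smul_apply, smul_eq_mul, zero_mul, add_zero]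

/-- [folklore] Hence the packed kinetic vertex is the scaled packed ghost current: `vertexRedF n (SghAt ρ n cK 0) μ y = cK • vertexRedF n ghCur μ y`. -/
theorem vertexRedF_SghAt_K (cK : ℝ) (μ : Fin 4) (y : Site 4) :
    vertexRedF n (SghAt ρ n cK 0) μ y = cK • vertexRedF n (fun κ u => ghCur κ u) μ y := by
  have e : SghAt ρ n cK 0 = fun κ u => cK • ghCur κ u := funext fun κ => funext fun u => SghAt_K_eq_smul ρ n κ cK u
  rw [e, vertexRedF_smul]

end Kinetic

section KineticMass
variable (m : ℕ)

/-- [folklore] **THE KINETIC JET'S MASS AT THE PIN `cK = n²`** (FILE 3b verbatim through `vertexRedF_SghAt_K`): for `0 ≤ σ ≤ κ₁∕(16n)` the centred weighted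
mass of `vertexRedF n (SghAt ρ n n² 0) μ y` is summable and `≤ 8·e^{κ₁∕16}·(M·P)·e^{κ₁}·(1 + 16∕κ₁)⁴ · n` — **power `n¹`**. -/
theorem mass_vertexRedF_SghAt_K_le (ρ : Site 4) {σ : ℝ} (hσ0 : 0 ≤ σ) (hσ : σ ≤ kappa163 (3 + 1) / (3 + 1) / (16 * ((m + 1 : ℕ) : ℝ)))
    (μ : Fin 4) (y : Site 4) :
    (Summable fun p : Site 4 × Site 4 => ∑ a, ∑ b,
        |vertexRedF (m + 1) (SghAt ρ (m + 1) (((m + 1 : ℕ) : ℝ) ^ 2) 0) μ y p.1 p.2 a b|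
          * Real.exp (σ * (l1 (p.1 - ((m + 1 : ℕ) : ℤ) • y) + l1 (p.2 - ((m + 1 : ℕ) : ℤ) • y)))) ∧
      ∑' p : Site 4 × Site 4, ∑ a, ∑ b,
        |vertexRedF (m + 1) (SghAt ρ (m + 1) (((m + 1 : ℕ) : ℝ) ^ 2) 0) μ y p.1 p.2 a b|
          * Real.exp (σ * (l1 (p.1 - ((m + 1 : ℕ) : ℤ) • y) + l1 (p.2 - ((m + 1 : ℕ) : ℤ) • y)))
        ≤ 8 * Real.exp (kappa163 (3 + 1) / (3 + 1) / 16) * (MG163 (3 + 1) * periodConst (kappa163 (3 + 1)) 3) * Real.exp (kappa163 (3 + 1) / (3 + 1))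
          * (1 + 16 / (kappa163 (3 + 1) / (3 + 1))) ^ 4 * ((m + 1 : ℕ) : ℝ) := by
  rw [vertexRedF_SghAt_K]
  exact mass_vertexRedF_ghCur_le m hσ0 hσ μ y

end KineticMass

/-! ## §3 The packed `Q′*Q′` table `W_Q` — power `n⁻¹` -/

section Table
variable (ρ : Site 4) (n : ℕ) [NeZero n]

omit [NeZero n] in
/-- [folklore] The `cQ`-sector of the completed table is the scaled stripped square table: `WghAt ρ n x₀ 0 cQ = (−(x₀·cQ·n⁴)) • qSqAt ρ n` (pointwise in the
bond indices; `GhostDeltaWords.diagExt_zero_smul` kills the kinetic diagonal). -/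
theorem WghAt_Q_eq (x₀ cQ : ℝ) : WghAt ρ n x₀ 0 cQ = fun κ v l v' => (-(x₀ * cQ * (n : ℝ) ^ 4)) • qSqAt ρ n κ v l v' := by
  funext κ v l v'
  rw [WghAt_eq, diagExt_zero_smul, zero_add]

/-- [folklore] Hence `tableRedF n (WghAt ρ n x₀ 0 cQ) μ y ν y′ = (−(x₀·cQ·n⁴)) • tableRedF n (qSqAt ρ n) μ y ν y′`. -/
theorem tableRedF_WghAt_Q (x₀ cQ : ℝ) (μ : Fin 4) (y : Site 4) (ν : Fin 4) (y' : Site 4) :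
    tableRedF n (WghAt ρ n x₀ 0 cQ) μ y ν y' = (-(x₀ * cQ * (n : ℝ) ^ 4)) • tableRedF n (qSqAt ρ n) μ y ν y' := by
  rw [WghAt_Q_eq, tableRedF_smul]

omit [NeZero n] in
/-- [folklore] The plain fibre mass of a scalar multiple: `Σ_{ab} |(c•K) x z a b| = |c|·Σ_{ab} |K x z a b|`. -/
theorem sum_abs_smul {F : Type*} [Fintype F] (c : ℝ) (K : MKer 4 F) (x z : Site 4) :
    ∑ a, ∑ b, |(c • K) x z a b| = |c| * ∑ a, ∑ b, |K x z a b| := by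
  rw [Finset.mul_sum]
  refine Finset.sum_congr rfl fun a _ => ?_
  rw [Finset.mul_sum]
  refine Finset.sum_congr rfl fun b _ => ?_
  rw [Pi.smul_apply, Pi.smul_apply, Pi.smul_apply, Pi.smul_apply, smul_eq_mul, abs_mul]

end Table

section TableMass
variable (m : ℕ)

/-- [folklore] **THE «ΔGH» TABLE'S PLAIN MASS IS `O(|x₀cQ|·n⁻¹)` WITH COARSE DECAY**: for an in-block root `ρ` and every coarse `z`, the plain ℓ¹-mass of
`tableRedF n (WghAt ρ n x₀ 0 cQ) μ 0 ν z` is summable and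
`≤ |x₀|·|cQ|·(64·e^{κ₁}·(M·P·e^{κ₁})²·(1 + 16∕κ₁)⁴) · n⁻¹ · e^{−(κ₁∕8)|z|₁}` — **power `n⁻¹`** (`n⁴ × n⁻⁵`, FILE 5c). -/
theorem mass_tableRedF_WghAt_Q_le {ρ : Site 4} (hρ : ∀ i : Fin 4, 0 ≤ ρ i ∧ ρ i < (m + 1 : ℕ)) (x₀ cQ : ℝ) (μ ν : Fin 4) (z : Site 4) :
    (Summable fun p : Site 4 × Site 4 => ∑ a, ∑ b, |tableRedF (m + 1) (WghAt ρ (m + 1) x₀ 0 cQ) μ 0 ν z p.1 p.2 a b|) ∧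
      ∑' p : Site 4 × Site 4, ∑ a, ∑ b, |tableRedF (m + 1) (WghAt ρ (m + 1) x₀ 0 cQ) μ 0 ν z p.1 p.2 a b|
        ≤ |x₀| * |cQ| * (64 * Real.exp (kappa163 (3 + 1) / (3 + 1)) *
            ((MG163 (3 + 1) * periodConst (kappa163 (3 + 1)) 3) * Real.exp (kappa163 (3 + 1) / (3 + 1))) ^ 2 * (1 + 16 / (kappa163 (3 + 1) / (3 + 1))) ^ 4) *
          (((m + 1 : ℕ) : ℝ))⁻¹ * Real.exp (-(kappa163 (3 + 1) / (3 + 1) / 8) * l1 z) := by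
  have h := mass_tableRedF_qSqAt_le m hρ μ ν z
  have hn : (0 : ℝ) < ((m + 1 : ℕ) : ℝ) := by exact_mod_cast Nat.succ_pos m
  rw [tableRedF_WghAt_Q]
  have e : (fun p : Site 4 × Site 4 => ∑ a, ∑ b,
      |((-(x₀ * cQ * (((m + 1 : ℕ) : ℕ) : ℝ) ^ 4)) • tableRedF (m + 1) (qSqAt ρ (m + 1)) μ 0 ν z) p.1 p.2 a b|)
      = fun p => |(-(x₀ * cQ * (((m + 1 : ℕ) : ℕ) : ℝ) ^ 4))| * ∑ a, ∑ b, |tableRedF (m + 1) (qSqAt ρ (m + 1)) μ 0 ν z p.1 p.2 a b| :=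
    funext fun p => sum_abs_smul _ _ p.1 p.2
  rw [e]
  refine ⟨h.1.mul_left _, ?_⟩
  rw [tsum_mul_left]
  have hc : |(-(x₀ * cQ * (((m + 1 : ℕ) : ℕ) : ℝ) ^ 4))| = |x₀| * |cQ| * (((m + 1 : ℕ) : ℝ)) ^ 4 := by
    rw [abs_neg, abs_mul, abs_mul, abs_of_nonneg (by positivity : (0 : ℝ) ≤ (((m + 1 : ℕ) : ℕ) : ℝ) ^ 4)]
  rw [hc]
  calc |x₀| * |cQ| * (((m + 1 : ℕ) : ℝ)) ^ 4 * ∑' p : Site 4 × Site 4, ∑ a, ∑ b, |tableRedF (m + 1) (qSqAt ρ (m + 1)) μ 0 ν z p.1 p.2 a b|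
      ≤ |x₀| * |cQ| * (((m + 1 : ℕ) : ℝ)) ^ 4 * (64 * Real.exp (kappa163 (3 + 1) / (3 + 1)) *
            ((MG163 (3 + 1) * periodConst (kappa163 (3 + 1)) 3) * Real.exp (kappa163 (3 + 1) / (3 + 1))) ^ 2 * (1 + 16 / (kappa163 (3 + 1) / (3 + 1))) ^ 4 *
          ((((m + 1 : ℕ) : ℝ)) ^ 5)⁻¹ * Real.exp (-(kappa163 (3 + 1) / (3 + 1) / 8) * l1 z)) :=
        mul_le_mul_of_nonneg_left h.2 (by positivity)
    _ = _ := by field_simp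

end TableMass

end Summit.QuantumFields.BalabanUV.Beta.D1BFx.GhostDeltaJetMasses
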